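import Summits.QuantumFields.BalabanUV.Beta.GAN24.HardMinimiserOneStepCubic
import Summits.QuantumFields.BalabanUV.Beta.GAN24.ScalarUnitLatticeTower

/-!
# G-an2-4 ∕ (CONV-C), road P2 — THE HARD SCALAR MINIMISER `H_n = M_n·S_n⁻¹ = G′_nQ′*(Q′G′_nQ′*)⁻¹` AT `U = 1` ON CUBIC UNIT TORI SATISFIES
# THE ROW's TWO-CLAUSE SHAPE ALONG THE TOWER `k ↦ H_{n_k}` (`n_k = lev L k = L^k`), UNCONDITIONALLY: `‖H_{n_k}(x,y)‖ ≤ C₆e^{−δ₆|blk x − y|}`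
# (k-uniform) AND `‖(H_{L·n_k} − J·H_{n_k})(x′,y)‖ ≤ C₆·(1∕√L)^k·e^{−δ₆|blk x′ − y|}`, PLUS the `η → 0` limit along nested sites

G-an2-4 formalisation swarm `b2b-balaban-gan24-formalise-*`, leaf prover 06 (gen 60), crux team (2) under the coordinator ruling «YM REDIRECT»
(e34b3e0c; FREEZE (0) honoured — a `GAN24/` corollary importing EXISTING modules only; no Support leaf, no `def`, no cite, no sorry).
WHY.  The row's target SHAPE for a constituent kernel is the (CONV-C) pair (`GAN24/DirichletExhaustion.ConvC`): k-UNIFORM decay AND a geometric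
one-step rate, ONE pair `(C, δ)`.  For road P2's `U = 1` SCALAR PROTOTYPE (`G′_n = (Δ + a′Q′*Q′)⁻¹`, `M_n = a′G′_nQ′*`, `S_n = Q′M_n`, `H_n = M_n·S_n⁻¹`;
`SoftMinimiserOneStepSup` ∕ `HardMinimiserOneStepSup`) the shape is a tree theorem for the `P`-type block `S_{L^k}` (leaf-06 g36,
`ScalarUnitLatticeTower.convC_shape_Savg_tower_cubic`) and the Σ-type block `(S_{L^k})⁻¹` (road P3 PART 111, `ScalarUnitLatticeTowerInverse`); the
one-step law of the HARD minimiser (0-form prototype of Bałaban's `GQ*(QGQ*)⁻¹`, [B5] (1.103) — text locator only) is UNCONDITIONAL on cubic tori since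
leaf-03 g49's append `HardMinimiserOneStepCubic` §2 (`norm_Mhard_succ_sub_stair_apply_le_cubic` & co.: gan24-p2 g29's ENDs with leaf-06 g35's ∕ leaf-01
g55's ∕ leaf-03 g49's letters plugged BY NAME).  NOT typed before: the n-UNIFORM DECAY of `H_n(x,y)` ITSELF (clause 1), the TOWER reading (clause 2
with `θ^k`), and the limit — the Ξ-type (fine × unit) block of the `U = 1` scalar triple `S ∕ S⁻¹ ∕ H`, in road P2's prolongation currency `H′ − J·H`
(`J = StaircaseLaplacianDefect.stair`).  THIS FILE:
 * §1 **`norm_Msoft_apply_le`**, **`norm_Mhard_apply_le`** — n-uniform ENTRY DECAY on EVERY torus (`ScalarZerothLetterTorus.rowDecay_Gps` at the staircase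
   `Q′*`; ONE unit-torus convolution with leaf-03's `SavgInverseUniform.norm_Savg_inv_apply_le`);
 * §2 **`norm_Mhard_succ_sub_stair_entry_le_cubic`** (leaf-03's kernel law in matrix-entry form), **`norm_Mhard_tower_step_le_cubic`** (tower `n_k = lev L k = L^k`,
   `R = L`, the tree's currency in which the fine carriers nest: `≤ C(1 + log L)(k+1)L^{−k}e^{−δ|blk x′ − y|}`, `ScalarUnitLatticeTower.tower_rate_le`);
 * §3 **`convC_shape_Mhard_tower_cubic`** — THE TWO CLAUSES, ONE pair `(C₆, δ₆)` (`δ₆(d,a′)`, `C₆(d,a′,L)` chosen BEFORE `N₀, k`), `θ = L^{−1∕2}`;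
 * §4 **`tendsto_Mhard_tower_cubic`** — the `η → 0` LIMIT along NESTED fine sites `par x_{k+1} = x_k` in the tree's tower currency `lev L k`
   (`stair_mul_apply`, `blockOf_nested(_succ)`): `H_{n_k}(x_k,y) → h`, `‖H_{n_k}(x_k,y) − h‖ ≤ C₇θ^k e^{−δ₆|blk x₀ − y|}`,
   `‖h‖ ≤ C₇e^{−δ₆|blk x₀ − y|}` — the Ξ-analogue of `ScalarUnitLatticeTower.tendsto_Savg_tower_cubic`.
HONEST SCOPE.  [folklore] corollaries of tree theorems BY NAME (one `obtain` per input, ONE convolution, real arithmetic, one geometric series; no new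
estimate); scalar (0-form) `U = 1` PROTOTYPE on CUBIC unit tori `fun _ : Fin (d+1) ⇒ N₀` (§1 on every torus), the unit torus FIXED along the tower;
constants ∕ rates EXISTENTIAL in size; `θ = L^{−1∕2}` absorbs the factor `(k+1)` (any `θ > L⁻¹` would do).  The SHAPE of `DirichletExhaustion.ConvC` ∕
`OpClose` for a fine × unit kernel, NOT an instance of that predicate; NOT the vector `H_k` (King's block-local minimiser, `HkKingOneStepSup`); NOT
(CONV-C) as typed (Bałaban's `(G_k, H_k, C^{(k)})` at general `U`), NEVER «G-an2-4 closed», NOT NE2 ∕ NE3, NOT D1, NOT BetaPertH, NOT continuum,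
NOT Clay; 0 def, 0 `def … : Prop`, 0 cite, 0 sorry — not in print, our bookkeeping.  HONEST DEPENDENCY: continuum YM on T⁴ ⇐ BetaPertH ∧ nine spine
estimates (0/9 proved); BetaPertH ⇐ (D1) ∧ (D4) ∧ CAP+tail; G-an2-4 gates asym, D1 and NE2/3/4.
-/

noncomputable section

open scoped BigOperators ComplexConjugate Matrix

namespace Summit.QuantumFields.BalabanUV.Beta.GAN24.HardMinimiserTowerCubic

open Literature.MathematicalPhysics.QuantumFieldTheory.Balaban1983to89
open B5Prop11Plancherel (Tor fine)
open B5Blocks16 (blockOf)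
open B6LowerBound2153Torus (rep)
open B4TorusKernel.MultiPeriod (torusSupNorm)
open B4Sect5Proof (latticeConst latticeConst_nonneg)
open Beta.TorusG0Decay (ldist ldist_symm ldist_triangle)
open Beta.EffectiveKernel (sum_exp_ldist_le)
open B5G183RateUnitTower (lev)
open Summit.QuantumFields.BalabanUV.T4Continuum.BalabanAveragedTowerUnit (cast_lev')
open Summit.QuantumFields.BalabanUV.T4Continuum.BalabanAveragedTowerModes (par)
open Summit.QuantumFields.BalabanUV.T4Continuum.ScalarPlantingDefect (blockOf_par)
open Summit.QuantumFields.BalabanUV.T4Continuum.ScalarAveragedPropagator (Gps)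
open Summit.QuantumFields.BalabanUV.Beta.GAN24.StaircaseLaplacianDefect (stair)
open Summit.QuantumFields.BalabanUV.Beta.GAN24.SoftMinimiserOneStepSup (blkInj Msoft)
open Summit.QuantumFields.BalabanUV.Beta.GAN24.HardMinimiserOneStepSup (Savg Mhard)
open Summit.QuantumFields.BalabanUV.Beta.GAN24.BlockFieldDecay (RowDecay FieldDecay)
open Summit.QuantumFields.BalabanUV.Beta.GAN24.SavgInverseUniform
  (sigmaS deltaS sigmaS_pos deltaS_pos norm_Savg_inv_apply_le ldist_nonneg ldist_eq_torusSupNorm)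
open Summit.QuantumFields.BalabanUV.Beta.GAN24.HardMinimiserOneStepCubic (norm_Mhard_succ_sub_stair_apply_le_cubic)
open Summit.QuantumFields.BalabanUV.Beta.GAN24.ScalarZerothLetterTorus (rowDecay_Gps)
open Summit.QuantumFields.BalabanUV.Beta.GAN24.Entry112SupLogCubic (latticeConst_succ_pos)
open Summit.QuantumFields.BalabanUV.Beta.GAN24.ScalarUnitLatticeTower (tower_rate_le)
open T4FlagMemoryPolyWeight (succ_mul_pow_le)

variable (d : ℕ)

/-! ## §1 Entry decay of the soft and hard minimisers, uniform in the level, on every torus -/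

/-- **THE SOFT MINIMISER's ENTRIES DECAY, n-UNIFORMLY, EVERY TORUS**: `∃ C δ > 0` (functions of `d, a′`) with
`‖M_n(x, y)‖ ≤ C·e^{−δ·|blockOf x − y|_{T,∞}}` for every `n ≥ 1`, every torus `M`, all `x, y` (`M_n = a′G′_nQ′*`; the zeroth letter
`ScalarZerothLetterTorus.rowDecay_Gps` read at the staircase `Q′*`). [folklore] -/
theorem norm_Msoft_apply_le {a' : ℝ} (ha' : 0 < a') :
    ∃ C δ : ℝ, 0 < C ∧ 0 < δ ∧ ∀ (n : ℕ) [NeZero n] (M : Fin (d + 1) → ℕ) [∀ μ, NeZero (M μ)]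
      (x : Tor (fine n M)) (y : Tor M),
        ‖Msoft n M a' x y‖ ≤ C * Real.exp (-(δ * torusSupNorm M (rep M (blockOf n M x) - rep M y))) := by
  obtain ⟨δ₀, C, hδ₀, hC, h⟩ := rowDecay_Gps d ha'
  refine ⟨a' * C, δ₀, by positivity, hδ₀, fun n _ M _ x y => ?_⟩
  have hrow := h n M x y
  have hM : Msoft n M a' x y = (a' : ℂ) * ∑ x', (if blockOf n M x' = y then Gps n M a' x x' else 0) := by
    simp only [Msoft, Matrix.smul_apply, smul_eq_mul, Matrix.mul_apply, blkInj, mul_ite, mul_one, mul_zero]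
  rw [hM, norm_mul, Complex.norm_real, Real.norm_of_nonneg ha'.le, mul_assoc]
  refine mul_le_mul_of_nonneg_left ((norm_sum_le _ _).trans (le_trans (Finset.sum_le_sum fun x' _ => ?_) hrow)) ha'.le
  split_ifs <;> simp

/-- **THE HARD MINIMISER's ENTRIES DECAY, n-UNIFORMLY, EVERY TORUS**: `∃ C δ > 0` (functions of `d, a′`) with
`‖H_n(x, y)‖ ≤ C·e^{−δ·|blockOf x − y|_{T,∞}}` for every `n ≥ 1`, every torus `M`, all `x, y` (`H_n = M_n·S_n⁻¹`; one unit-torus convolution of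
`norm_Msoft_apply_le` with leaf-03's `SavgInverseUniform.norm_Savg_inv_apply_le`). [folklore] -/
theorem norm_Mhard_apply_le {a' : ℝ} (ha' : 0 < a') :
    ∃ C δ : ℝ, 0 < C ∧ 0 < δ ∧ ∀ (n : ℕ) [NeZero n] (M : Fin (d + 1) → ℕ) [∀ μ, NeZero (M μ)]
      (x : Tor (fine n M)) (y : Tor M),
        ‖Mhard n M a' x y‖ ≤ C * Real.exp (-(δ * torusSupNorm M (rep M (blockOf n M x) - rep M y))) := by
  obtain ⟨C, δ₀, hC, hδ₀, hMs⟩ := norm_Msoft_apply_le d ha'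
  have hσ := sigmaS_pos d ha'
  have hδS := deltaS_pos d ha'
  set t : ℝ := min δ₀ (deltaS d a') with ht_def
  have ht : 0 < t := lt_min hδ₀ hδS
  have hK : 0 < latticeConst (d + 1) (t / 2) := latticeConst_succ_pos (d := d) (by linarith)
  refine ⟨C * sigmaS d a' * latticeConst (d + 1) (t / 2), t / 2, by positivity, by linarith, fun n _ M _ x y => ?_⟩
  rw [← ldist_eq_torusSupNorm]
  set b := blockOf n M x
  -- termwise: `‖M(x,y₁)‖·‖S⁻¹(y₁,y)‖ ≤ Cσ·e^{−(t/2)d(b,y)}·e^{−(t/2)d(b,y₁)}`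
  have hpt : ∀ y₁, ‖Msoft n M a' x y₁ * (Savg n M a')⁻¹ y₁ y‖
      ≤ C * sigmaS d a' * Real.exp (-(t / 2 * ldist M b y)) * Real.exp (-(t / 2 * ldist M b y₁)) := by
    intro y₁
    have h1 := hMs n M x y₁
    rw [← ldist_eq_torusSupNorm] at h1
    have h2 := norm_Savg_inv_apply_le n M ha' y₁ y
    have hd1 := ldist_nonneg M b y₁
    have hd2 := ldist_nonneg M y₁ y
    have htri := ldist_triangle M b y₁ y
    have e1 : Real.exp (-(δ₀ * ldist M b y₁)) ≤ Real.exp (-(t * ldist M b y₁)) :=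
      Real.exp_le_exp.mpr (by nlinarith [min_le_left δ₀ (deltaS d a')])
    have e2 : Real.exp (-(deltaS d a' * ldist M y₁ y)) ≤ Real.exp (-(t * ldist M y₁ y)) :=
      Real.exp_le_exp.mpr (by nlinarith [min_le_right δ₀ (deltaS d a')])
    have e3 : Real.exp (-(t * ldist M b y₁)) * Real.exp (-(t * ldist M y₁ y))
        ≤ Real.exp (-(t / 2 * ldist M b y)) * Real.exp (-(t / 2 * ldist M b y₁)) := by
      rw [← Real.exp_add, ← Real.exp_add]
      exact Real.exp_le_exp.mpr (by nlinarith)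
    rw [norm_mul]
    calc ‖Msoft n M a' x y₁‖ * ‖(Savg n M a')⁻¹ y₁ y‖
        ≤ (C * Real.exp (-(t * ldist M b y₁))) * (sigmaS d a' * Real.exp (-(t * ldist M y₁ y))) :=
          mul_le_mul (h1.trans (mul_le_mul_of_nonneg_left e1 hC.le)) (h2.trans (mul_le_mul_of_nonneg_left e2 hσ.le))
            (norm_nonneg _) (by positivity)
      _ = C * sigmaS d a' * (Real.exp (-(t * ldist M b y₁)) * Real.exp (-(t * ldist M y₁ y))) := by ring
      _ ≤ C * sigmaS d a' * (Real.exp (-(t / 2 * ldist M b y)) * Real.exp (-(t / 2 * ldist M b y₁))) :=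
          mul_le_mul_of_nonneg_left e3 (by positivity)
      _ = _ := by ring
  rw [Mhard, Matrix.mul_apply]
  calc ‖∑ y₁, Msoft n M a' x y₁ * (Savg n M a')⁻¹ y₁ y‖
      ≤ ∑ y₁, ‖Msoft n M a' x y₁ * (Savg n M a')⁻¹ y₁ y‖ := norm_sum_le _ _
    _ ≤ ∑ y₁, C * sigmaS d a' * Real.exp (-(t / 2 * ldist M b y)) * Real.exp (-(t / 2 * ldist M b y₁)) :=
        Finset.sum_le_sum fun y₁ _ => hpt y₁
    _ = C * sigmaS d a' * Real.exp (-(t / 2 * ldist M b y)) * ∑ y₁, Real.exp (-(t / 2 * ldist M b y₁)) := by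
        rw [Finset.mul_sum]
    _ ≤ C * sigmaS d a' * Real.exp (-(t / 2 * ldist M b y)) * latticeConst (d + 1) (t / 2) :=
        mul_le_mul_of_nonneg_left (sum_exp_ldist_le M b (by linarith)) (by positivity)
    _ = C * sigmaS d a' * latticeConst (d + 1) (t / 2) * Real.exp (-(t / 2 * ldist M b y)) := by ring

/-! ## §2 The one-step kernel along the tower `k ↦ H_{n_k}`, `n_k = lev L k`, on cubic unit tori -/

/-- **THE HARD MINIMISER's ONE-STEP KERNEL ON CUBIC TORI, matrix-entry form** of leaf-03 gen 49's
`HardMinimiserOneStepCubic.norm_Mhard_succ_sub_stair_apply_le_cubic` (there read at the indicator source `δ_{y′}`): `∃ C δ > 0` (functions of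
`d, a′`) with, for all `N, R, N₀ ≥ 1`, every fine site `x′` of the `R·N`-lattice and every unit site `y′`,
`‖(H_{RN} − J·H_N)(x′, y′)‖ ≤ C·((R−1)∕(RN))·(2 + log(RN) + log N)·e^{−δ·|blockOf x′ − y′|_{T,∞}}`. [folklore] -/
theorem norm_Mhard_succ_sub_stair_entry_le_cubic {a' : ℝ} (ha' : 0 < a') :
    ∃ C δ : ℝ, 0 < C ∧ 0 < δ ∧ ∀ (N R N₀ : ℕ) [NeZero N] [NeZero R] [NeZero N₀]
      (x' : Tor (fine (R * N) (fun _ : Fin (d + 1) => N₀))) (y' : Tor (fun _ : Fin (d + 1) => N₀)),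
        ‖(Mhard (R * N) (fun _ : Fin (d + 1) => N₀) a'
            - stair N R (fun _ : Fin (d + 1) => N₀) * Mhard N (fun _ : Fin (d + 1) => N₀) a') x' y'‖
          ≤ C * (((R : ℝ) - 1) / ((R : ℝ) * N)) * (2 + Real.log ((R * N : ℕ) : ℝ) + Real.log (N : ℝ))
              * Real.exp (-(δ * torusSupNorm (fun _ : Fin (d + 1) => N₀)
                  (rep (fun _ : Fin (d + 1) => N₀) (blockOf (R * N) (fun _ : Fin (d + 1) => N₀) x')
                    - rep (fun _ : Fin (d + 1) => N₀) y'))) := by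
  obtain ⟨C, δ, hC, hδ, h⟩ := norm_Mhard_succ_sub_stair_apply_le_cubic d ha'
  refine ⟨C, δ / 32, hC, by linarith, fun N R N₀ _ _ _ x' y' => ?_⟩
  have key := h N R N₀ x' y'
  -- the indicator-source reading IS the matrix entry of `H′ − J·H`
  rw [Matrix.mulVec_mulVec, ← Matrix.sub_mulVec, Matrix.mulVec_single_one, Matrix.col_apply] at key
  exact key

/-- **THE TOWER STEP OF THE HARD MINIMISER, UNCONDITIONAL** (tower `n_k = lev L k = L^k`, `R = L`; the tree's currency in which the fine carriers NEST,
`lev L (k+1) = L·lev L k` by `rfl`): `∃ C δ > 0` (functions of `d, a′`) with, for every `L ≥ 1`, `N₀ ≥ 1`, `k`, every fine site `x′` of level `k+1`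
(carrier `Tor (fine (L·n_k) T)`) and unit site `y`, `‖(H_{L·n_k} − J·H_{n_k})(x′, y)‖ ≤ C·(1 + log L)·(k+1)·L^{−k}·e^{−δ·|blockOf x′ − y|_{T,∞}}`. [folklore] -/
theorem norm_Mhard_tower_step_le_cubic {a' : ℝ} (ha' : 0 < a') :
    ∃ C δ : ℝ, 0 < C ∧ 0 < δ ∧ ∀ (L N₀ : ℕ) [NeZero L] [NeZero N₀] (k : ℕ)
      (x' : Tor (fine (L * lev L k) (fun _ : Fin (d + 1) => N₀))) (y : Tor (fun _ : Fin (d + 1) => N₀)),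
        ‖(Mhard (L * lev L k) (fun _ : Fin (d + 1) => N₀) a'
            - stair (lev L k) L (fun _ : Fin (d + 1) => N₀) * Mhard (lev L k) (fun _ : Fin (d + 1) => N₀) a') x' y‖
          ≤ C * (1 + Real.log (L : ℝ)) * ((k : ℝ) + 1) / (L : ℝ) ^ k
              * Real.exp (-(δ * torusSupNorm (fun _ : Fin (d + 1) => N₀)
                  (rep (fun _ : Fin (d + 1) => N₀) (blockOf (L * lev L k) (fun _ : Fin (d + 1) => N₀) x')
                    - rep (fun _ : Fin (d + 1) => N₀) y))) := by
  obtain ⟨C, δ, hC, hδ, h⟩ := norm_Mhard_succ_sub_stair_entry_le_cubic d ha'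
  refine ⟨2 * C, δ, by positivity, hδ, fun L N₀ _ _ k x' y => ?_⟩
  have hL : (1 : ℝ) ≤ L := by exact_mod_cast Nat.one_le_iff_ne_zero.mpr (NeZero.ne L)
  set E := Real.exp (-(δ * torusSupNorm (fun _ : Fin (d + 1) => N₀)
    (rep (fun _ : Fin (d + 1) => N₀) (blockOf (L * lev L k) (fun _ : Fin (d + 1) => N₀) x') - rep (fun _ : Fin (d + 1) => N₀) y)))
  have hE : 0 ≤ E := (Real.exp_pos _).le
  have key := h (lev L k) L N₀ x' y
  push_cast at key
  rw [cast_lev', show (L : ℝ) * (L : ℝ) ^ k = (L : ℝ) ^ (k + 1) from (pow_succ' _ _).symm, Real.log_pow, Real.log_pow] at key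
  have hr := tower_rate_le hL k
  calc ‖(Mhard (L * lev L k) (fun _ : Fin (d + 1) => N₀) a'
          - stair (lev L k) L (fun _ : Fin (d + 1) => N₀) * Mhard (lev L k) (fun _ : Fin (d + 1) => N₀) a') x' y‖
      ≤ C * (((L : ℝ) - 1) / (L : ℝ) ^ (k + 1)) * (2 + ((k + 1 : ℕ) : ℝ) * Real.log L + (k : ℝ) * Real.log L) * E := key
    _ = C * (((L : ℝ) - 1) / (L : ℝ) ^ (k + 1) * (2 + ((k : ℝ) + 1) * Real.log L + (k : ℝ) * Real.log L)) * E := by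
        push_cast; ring
    _ ≤ C * (2 * (1 + Real.log L) * ((k : ℝ) + 1) / L ^ k) * E :=
        mul_le_mul_of_nonneg_right (mul_le_mul_of_nonneg_left hr hC.le) hE
    _ = 2 * C * (1 + Real.log (L : ℝ)) * ((k : ℝ) + 1) / (L : ℝ) ^ k * E := by ring

/-! ## §3 The two clauses of the (CONV-C) shape for the hard scalar minimiser `k ↦ H_{n_k}`, on every cubic unit torus -/

variable {d} in
/-- the geometric scale `y = 1∕√L` of the lineage's tower readings (`L > 1`): `0 < y < 1` and, for `C ≥ 0`,
`C(1 + log L)(k+1)∕L^k ≤ (C(1 + log L)∕(1 − y))·y^k` (`(k+1)L^{−k} = ((k+1)y^k)·y^k ≤ y^k∕(1 − y)`, `T4FlagMemoryPolyWeight.succ_mul_pow_le`). [folklore] -/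
theorem geometric_scale {L : ℕ} (hL1 : (1 : ℝ) < L) {C : ℝ} (hC : 0 ≤ C) (k : ℕ) :
    0 < (Real.sqrt L)⁻¹ ∧ (Real.sqrt L)⁻¹ < 1 ∧
      C * (1 + Real.log (L : ℝ)) * ((k : ℝ) + 1) / (L : ℝ) ^ k
        ≤ C * (1 + Real.log (L : ℝ)) / (1 - (Real.sqrt L)⁻¹) * ((Real.sqrt L)⁻¹) ^ k := by
  have hL0 : (0 : ℝ) < L := by linarith
  have hlog : 0 ≤ Real.log (L : ℝ) := Real.log_nonneg hL1.le
  set y : ℝ := (Real.sqrt L)⁻¹ with hy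
  have hsq : 1 < Real.sqrt L := by
    rw [show (1 : ℝ) = Real.sqrt 1 from Real.sqrt_one.symm]
    exact Real.sqrt_lt_sqrt zero_le_one hL1
  have hy0 : 0 < y := inv_pos.mpr (by linarith)
  have hy1 : y < 1 := inv_lt_one_of_one_lt₀ hsq
  have hyy : ((L : ℝ) ^ k)⁻¹ = y ^ k * y ^ k := by rw [hy, ← mul_pow, ← mul_inv, Real.mul_self_sqrt hL0.le, inv_pow]
  have hyk : 0 ≤ y ^ k := pow_nonneg hy0.le k
  refine ⟨hy0, hy1, ?_⟩
  calc C * (1 + Real.log (L : ℝ)) * ((k : ℝ) + 1) / (L : ℝ) ^ k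
      = C * (1 + Real.log (L : ℝ)) * (((k : ℝ) + 1) * y ^ k) * y ^ k := by rw [div_eq_mul_inv, hyy]; ring
    _ ≤ C * (1 + Real.log (L : ℝ)) * (1 / (1 - y)) * y ^ k :=
        mul_le_mul_of_nonneg_right (mul_le_mul_of_nonneg_left (succ_mul_pow_le hy0.le hy1 k) (by positivity)) hyk
    _ = C * (1 + Real.log L) / (1 - y) * y ^ k := by ring

/-- **THE (CONV-C) TWO-CLAUSE SHAPE FOR THE HARD SCALAR MINIMISER `H_{L^k} = G′Q′*(Q′G′Q′*)⁻¹` ON CUBIC UNIT TORI, UNCONDITIONAL.**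
There is a rate `δ₆ > 0` (a function of `d, a′`) such that for every `L ≥ 2` there is `C₆ > 0` (a function of `d, a′, L`) with, for every
`N₀ ≥ 1` and every level `k` (cubic unit torus `Π_μ ℤ/N₀`, dimension `d+1`):
(1) `‖H_{n_k}(x, y)‖ ≤ C₆·e^{−δ₆|blockOf x − y|_{T,∞}}` for all fine `x`, unit `y` (k-UNIFORM DECAY), and
(2) `‖(H_{L·n_k} − J·H_{n_k})(x′, y)‖ ≤ C₆·(1∕√L)^k·e^{−δ₆|blockOf x′ − y|_{T,∞}}` for all fine `x′`, unit `y` (GEOMETRIC ONE-STEP RATE,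
`θ = L^{−1∕2}`), ONE pair `(C₆, δ₆)`; `n_k = lev L k = L^k` (`BalabanAveragedTowerUnit.cast_lev'`). [folklore] -/
theorem convC_shape_Mhard_tower_cubic {a' : ℝ} (ha' : 0 < a') :
    ∃ δ₆ : ℝ, 0 < δ₆ ∧ ∀ (L : ℕ) [NeZero L], 2 ≤ L → ∃ C₆ : ℝ, 0 < C₆ ∧ ∀ (N₀ : ℕ) [NeZero N₀] (k : ℕ),
      (∀ (x : Tor (fine (lev L k) (fun _ : Fin (d + 1) => N₀))) (y : Tor (fun _ : Fin (d + 1) => N₀)),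
        ‖Mhard (lev L k) (fun _ : Fin (d + 1) => N₀) a' x y‖
          ≤ C₆ * Real.exp (-(δ₆ * torusSupNorm (fun _ : Fin (d + 1) => N₀)
              (rep (fun _ : Fin (d + 1) => N₀) (blockOf (lev L k) (fun _ : Fin (d + 1) => N₀) x) - rep (fun _ : Fin (d + 1) => N₀) y)))) ∧
      (∀ (x' : Tor (fine (L * lev L k) (fun _ : Fin (d + 1) => N₀))) (y : Tor (fun _ : Fin (d + 1) => N₀)),
        ‖(Mhard (L * lev L k) (fun _ : Fin (d + 1) => N₀) a'
            - stair (lev L k) L (fun _ : Fin (d + 1) => N₀) * Mhard (lev L k) (fun _ : Fin (d + 1) => N₀) a') x' y‖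
          ≤ C₆ * ((Real.sqrt L)⁻¹) ^ k * Real.exp (-(δ₆ * torusSupNorm (fun _ : Fin (d + 1) => N₀)
              (rep (fun _ : Fin (d + 1) => N₀) (blockOf (L * lev L k) (fun _ : Fin (d + 1) => N₀) x')
                - rep (fun _ : Fin (d + 1) => N₀) y)))) := by
  obtain ⟨C, δ, hC, hδ, h⟩ := norm_Mhard_tower_step_le_cubic d ha'
  obtain ⟨CH, δH, hCH, hδH, hH⟩ := norm_Mhard_apply_le d ha'
  refine ⟨min δ δH, lt_min hδ hδH, fun L _ hL2 => ?_⟩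
  have hL1 : (1 : ℝ) < L := by exact_mod_cast hL2
  obtain ⟨hy0, hy1, -⟩ := geometric_scale hL1 hC.le 0
  set y : ℝ := (Real.sqrt L)⁻¹ with hy
  set C₆ := max CH (C * (1 + Real.log L) / (1 - y))
  have hC₆pos : 0 < C₆ := lt_max_of_lt_left hCH
  refine ⟨C₆, hC₆pos, fun N₀ _ k => ⟨fun x y₂ => ?_, fun x' y₂ => ?_⟩⟩
  · -- clause 1: k-uniform decay (§1), rate lowered to `δ₆ ≤ δ_H`
    set t := torusSupNorm (fun _ : Fin (d + 1) => N₀)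
      (rep (fun _ : Fin (d + 1) => N₀) (blockOf (lev L k) (fun _ : Fin (d + 1) => N₀) x) - rep (fun _ : Fin (d + 1) => N₀) y₂)
    have ht : 0 ≤ t :=
      B4TorusKernel.MultiPeriod.torusSupNorm_nonneg (fun _ => Nat.one_le_iff_ne_zero.mpr (NeZero.ne N₀)) _
    have h1 := hH (lev L k) (fun _ : Fin (d + 1) => N₀) x y₂
    have hE : Real.exp (-(δH * t)) ≤ Real.exp (-(min δ δH * t)) :=
      Real.exp_le_exp.mpr (by nlinarith [min_le_right δ δH])
    exact h1.trans (mul_le_mul (le_max_left _ _) hE (Real.exp_pos _).le hC₆pos.le)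
  · -- clause 2: the tower step (§2), with `(k+1)·L^{−k} = ((k+1)·y^k)·y^k ≤ y^k∕(1 − y)`
    set t := torusSupNorm (fun _ : Fin (d + 1) => N₀)
      (rep (fun _ : Fin (d + 1) => N₀) (blockOf (L * lev L k) (fun _ : Fin (d + 1) => N₀) x') - rep (fun _ : Fin (d + 1) => N₀) y₂)
    have ht : 0 ≤ t :=
      B4TorusKernel.MultiPeriod.torusSupNorm_nonneg (fun _ => Nat.one_le_iff_ne_zero.mpr (NeZero.ne N₀)) _
    have h2 := h L N₀ k x' y₂
    have hE : Real.exp (-(δ * t)) ≤ Real.exp (-(min δ δH * t)) :=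
      Real.exp_le_exp.mpr (by nlinarith [min_le_left δ δH])
    have hyk : 0 ≤ y ^ k := pow_nonneg hy0.le k
    have hcoef : C * (1 + Real.log (L : ℝ)) * ((k : ℝ) + 1) / (L : ℝ) ^ k ≤ C₆ * y ^ k :=
      (geometric_scale hL1 hC.le k).2.2.trans (mul_le_mul_of_nonneg_right (le_max_right _ _) hyk)
    exact h2.trans (mul_le_mul hcoef hE (Real.exp_pos _).le (mul_nonneg hC₆pos.le hyk))

/-! ## §4 The `η → 0` limit along NESTED fine sites (the tree's tower currency `lev L k`, `lev L (k+1) = L·lev L k` by `rfl`):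
the fine carrier changes with the level, so the entrywise limit of `H_{n_k}(·, y)` is read along `par x_{k+1} = x_k` (all `x_k` over ONE unit
block), where `H_{n_{k+1}}(x_{k+1}, y) − H_{n_k}(x_k, y) = (H_{L·n_k} − J·H_{n_k})(x_{k+1}, y)` IS the one-step kernel of §2 -/

section Limit

open Filter

variable {d} in
/-- `(J·A)(x′, y) = A(par x′, y)`: the block-parent staircase reads a fine × unit kernel at the parent site. [folklore] -/
theorem stair_mul_apply {N R : ℕ} [NeZero N] [NeZero R] {T : Fin (d + 1) → ℕ} [∀ μ, NeZero (T μ)]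
    (A : Matrix (Tor (fine N T)) (Tor T) ℂ) (x' : Tor (fine (R * N) T)) (y : Tor T) :
    (stair N R T * A) x' y = A (par N R T x') y := by
  simp only [Matrix.mul_apply, stair, ite_mul, one_mul, zero_mul, Finset.sum_ite_eq, Finset.mem_univ, if_true]

variable {d} in
/-- nested fine sites (`par x_{k+1} = x_k`) lie over ONE unit block: `blockOf x_k = blockOf x_0`. [folklore] -/
theorem blockOf_nested {L : ℕ} [NeZero L] {T : Fin (d + 1) → ℕ} [∀ μ, NeZero (T μ)]
    (x : (k : ℕ) → Tor (fine (lev L k) T)) (hx : ∀ k, par (lev L k) L T (x (k + 1)) = x k) (k : ℕ) :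
    blockOf (lev L k) T (x k) = blockOf (lev L 0) T (x 0) := by
  induction k with
  | zero => rfl
  | succ k ih =>
    have h2 : blockOf (L * lev L k) T (x (k + 1)) = blockOf (lev L k) T (par (lev L k) L T (x (k + 1))) :=
      (blockOf_par (lev L k) L T (x (k + 1))).symm
    rw [hx k, ih] at h2
    exact h2

variable {d} in
/-- the same at a successor level, in the product form `L·n_k` the one-step kernels are typed in. [folklore] -/
theorem blockOf_nested_succ {L : ℕ} [NeZero L] {T : Fin (d + 1) → ℕ} [∀ μ, NeZero (T μ)]
    (x : (k : ℕ) → Tor (fine (lev L k) T)) (hx : ∀ k, par (lev L k) L T (x (k + 1)) = x k) (k : ℕ) :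
    blockOf (L * lev L k) T (x (k + 1)) = blockOf (lev L 0) T (x 0) := by
  rw [← blockOf_par (lev L k) L T (x (k + 1)), hx k]
  exact blockOf_nested x hx k

/-- **THE `η → 0` LIMIT OF THE HARD SCALAR MINIMISER ALONG NESTED SITES, UNCONDITIONAL**: there is `δ₆ > 0` (a function of `d, a′`) such that for
every `L ≥ 2` there is `C₇ > 0` (a function of `d, a′, L`) with: on every cubic unit torus, for every NESTED sequence of fine sites
`x_k ∈ Tor (fine n_k T)` (`par x_{k+1} = x_k`, `n_k = lev L k = L^k`) and every unit site `y` there is `h ∈ ℂ` with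
`H_{n_k}(x_k, y) → h` (`k → ∞`), `‖H_{n_k}(x_k, y) − h‖ ≤ C₇·(1∕√L)^k·e^{−δ₆|blockOf x₀ − y|_{T,∞}}` for every `k`, and `‖h‖ ≤ C₇·e^{−δ₆|blockOf x₀ − y|_{T,∞}}`
— the `lev` tower step summed geometrically (`cauchySeq_of_le_geometric`, completeness of `ℂ`, `dist_le_of_le_geometric_of_tendsto`) and §1 passed
to the limit; `C₇ = 2·max(C_H, C(1 + log L)∕(1 − 1∕√L))∕(1 − 1∕√L)`. [folklore] -/
theorem tendsto_Mhard_tower_cubic {a' : ℝ} (ha' : 0 < a') :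
    ∃ δ₆ : ℝ, 0 < δ₆ ∧ ∀ (L : ℕ) [NeZero L], 2 ≤ L → ∃ C₇ : ℝ, 0 < C₇ ∧ ∀ (N₀ : ℕ) [NeZero N₀]
      (x : (k : ℕ) → Tor (fine (lev L k) (fun _ : Fin (d + 1) => N₀)))
      (_ : ∀ k, par (lev L k) L (fun _ : Fin (d + 1) => N₀) (x (k + 1)) = x k) (y : Tor (fun _ : Fin (d + 1) => N₀)),
      ∃ h : ℂ, Tendsto (fun k : ℕ => Mhard (lev L k) (fun _ : Fin (d + 1) => N₀) a' (x k) y) atTop (nhds h) ∧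
        (∀ k : ℕ, ‖Mhard (lev L k) (fun _ : Fin (d + 1) => N₀) a' (x k) y - h‖
            ≤ C₇ * ((Real.sqrt L)⁻¹) ^ k * Real.exp (-(δ₆ * torusSupNorm (fun _ : Fin (d + 1) => N₀)
                (rep (fun _ : Fin (d + 1) => N₀) (blockOf (lev L 0) (fun _ : Fin (d + 1) => N₀) (x 0))
                  - rep (fun _ : Fin (d + 1) => N₀) y)))) ∧
        ‖h‖ ≤ C₇ * Real.exp (-(δ₆ * torusSupNorm (fun _ : Fin (d + 1) => N₀)
            (rep (fun _ : Fin (d + 1) => N₀) (blockOf (lev L 0) (fun _ : Fin (d + 1) => N₀) (x 0))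
              - rep (fun _ : Fin (d + 1) => N₀) y))) := by
  obtain ⟨C, δ, hC, hδ, h⟩ := norm_Mhard_tower_step_le_cubic d ha'
  obtain ⟨CH, δH, hCH, hδH, hH⟩ := norm_Mhard_apply_le d ha'
  refine ⟨min δ δH, lt_min hδ hδH, fun L _ hL2 => ?_⟩
  have hL1 : (1 : ℝ) < L := by exact_mod_cast hL2
  obtain ⟨hθ0, hθ1, -⟩ := geometric_scale hL1 hC.le 0
  set θ : ℝ := (Real.sqrt L)⁻¹ with hθ
  have h1θ : 0 < 1 - θ := by linarith
  set C₆ := max CH (C * (1 + Real.log L) / (1 - θ)) with hC₆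
  have hC₆pos : 0 < C₆ := lt_max_of_lt_left hCH
  refine ⟨2 * C₆ / (1 - θ), by positivity, fun N₀ _ x hx y => ?_⟩
  -- the common localisation weight, read at the level-0 block
  set t := torusSupNorm (fun _ : Fin (d + 1) => N₀)
    (rep (fun _ : Fin (d + 1) => N₀) (blockOf (lev L 0) (fun _ : Fin (d + 1) => N₀) (x 0)) - rep (fun _ : Fin (d + 1) => N₀) y)
    with ht_def
  have ht : 0 ≤ t :=
    B4TorusKernel.MultiPeriod.torusSupNorm_nonneg (fun _ => Nat.one_le_iff_ne_zero.mpr (NeZero.ne N₀)) _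
  set E := Real.exp (-(min δ δH * t)) with hE_def
  have hE0 : 0 < E := Real.exp_pos _
  set u : ℕ → ℂ := fun k => Mhard (lev L k) (fun _ : Fin (d + 1) => N₀) a' (x k) y with hu
  -- the one-step increments along nested sites
  have hstep : ∀ k, dist (u k) (u (k + 1)) ≤ C₆ * E * θ ^ k := by
    intro k
    rw [dist_comm, dist_eq_norm]
    have h2 := h L N₀ k (x (k + 1)) y
    rw [Matrix.sub_apply, stair_mul_apply, hx k, blockOf_nested_succ x hx k] at h2
    have hEδ : Real.exp (-(δ * t)) ≤ E := Real.exp_le_exp.mpr (by nlinarith [min_le_left δ δH])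
    have hθk : 0 ≤ θ ^ k := pow_nonneg hθ0.le k
    have hcoef : C * (1 + Real.log (L : ℝ)) * ((k : ℝ) + 1) / (L : ℝ) ^ k ≤ C₆ * θ ^ k :=
      (geometric_scale hL1 hC.le k).2.2.trans (mul_le_mul_of_nonneg_right (le_max_right _ _) hθk)
    calc ‖u (k + 1) - u k‖ ≤ C * (1 + Real.log (L : ℝ)) * ((k : ℝ) + 1) / (L : ℝ) ^ k * Real.exp (-(δ * t)) := h2
      _ ≤ C₆ * θ ^ k * E := mul_le_mul hcoef hEδ (Real.exp_pos _).le (mul_nonneg hC₆pos.le hθk)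
      _ = C₆ * E * θ ^ k := by ring
  have hcau : CauchySeq u := cauchySeq_of_le_geometric θ (C₆ * E) hθ1 hstep
  obtain ⟨s, hs⟩ := cauchySeq_tendsto_of_complete hcau
  have hdist : ∀ k, dist (u k) s ≤ C₆ * E * θ ^ k / (1 - θ) := fun k =>
    dist_le_of_le_geometric_of_tendsto θ (C₆ * E) hθ1 hstep hs k
  have hCE : 0 ≤ C₆ * E := by positivity
  refine ⟨s, hs, fun k => ?_, ?_⟩
  · have hk := hdist k
    rw [dist_eq_norm] at hk
    have hθk : 0 ≤ θ ^ k := pow_nonneg hθ0.le k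
    calc ‖u k - s‖ ≤ C₆ * E * θ ^ k / (1 - θ) := hk
      _ ≤ 2 * (C₆ * E * θ ^ k) / (1 - θ) := by
          rw [div_le_div_iff_of_pos_right h1θ]; nlinarith [mul_nonneg hCE hθk]
      _ = 2 * C₆ / (1 - θ) * θ ^ k * E := by ring
  · -- the limit inherits clause 1's localisation: `‖s‖ ≤ ‖u 0‖ + dist (u 0) s`
    have h0 := hdist 0
    rw [pow_zero, mul_one, dist_eq_norm] at h0
    have hu0 : ‖u 0‖ ≤ C₆ * E := by
      have h1 := hH (lev L 0) (fun _ : Fin (d + 1) => N₀) (x 0) y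
      have hEH : Real.exp (-(δH * t)) ≤ E := Real.exp_le_exp.mpr (by nlinarith [min_le_right δ δH])
      exact h1.trans (mul_le_mul (le_max_left _ _) hEH (Real.exp_pos _).le hC₆pos.le)
    have htri : ‖s‖ ≤ ‖u 0‖ + ‖u 0 - s‖ := by
      have := norm_sub_le (u 0) (u 0 - s)
      rwa [sub_sub_cancel] at this
    calc ‖s‖ ≤ C₆ * E + C₆ * E / (1 - θ) := htri.trans (add_le_add hu0 h0)
      _ = C₆ * E * (1 + 1 / (1 - θ)) := by ring
      _ ≤ C₆ * E * (2 / (1 - θ)) := by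
          apply mul_le_mul_of_nonneg_left _ hCE
          rw [add_div' _ _ _ h1θ.ne', div_le_div_iff_of_pos_right h1θ]
          nlinarith
      _ = 2 * C₆ / (1 - θ) * E := by ring

end Limit

end Summit.QuantumFields.BalabanUV.Beta.GAN24.HardMinimiserTowerCubic

end
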